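import Literature.AlgebraicGeometry.Motives.HodgeStructureExteriorAlgebraWeylOperator
import Literature.AlgebraicGeometry.Motives.HodgeStructureHodgeStarLefschetzGroup
import HarnessLib

/-!
# André's Weyl element `w` and involution `*_H` on a polarized `ℚ`-Hodge structure: they COMMUTE WITH THE BASE CHANGE `Θ` AND WITH
# THE LEFSCHETZ GROUP `S(H)(ℂ)`, preserve the `ℚ`-algebra of Lefschetz classes `ℚ[B¹]`, and carry `Dᵖ` onto `D^{g-p}`

[topic AlgebraicGeometry/Motives]

Layer `Literature/AlgebraicGeometry/Motives`, lane `lit-hodgefound` (Track 2 foundations library; prover seat `lit-hodgefound-p34`,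
generation 31, row g31-#7). THEOREMS ONLY (no `def`, no named fact, no instance, no notation; net debt `0`). Sequel of rows g31-#3
(`Motives/HodgeStructureExteriorAlgebraWeylOperator`: `weylStar ω g = w = exp(ᶜΛ) exp(−L) exp(ᶜΛ)` and `andreStar ω g = *_H` (ANDRÉ'S
normalisation, with the factor `k!/(d−j+k)!`) on `ExteriorAlgebra K W`, their string formulas, `w, *_H ∈ K[e_ω, *_L]`
(`IsSymplectic.weylStar_mem_adjoin_lefschetzStar`, `IsSymplectic.andreStar_mem_adjoin_lefschetzStar`) and `Sp(ω)`-equivariance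
`IsSymplectic.map_weylStar` / `IsSymplectic.map_andreStar`) and g29-#6 (`Motives/HodgeStructureHodgeStarLefschetzGroup`: the same road
for `*_L` and Milne's `∗`, and the two general statements `Polarization.apply_mem_adjoin_hodgeClasses_two_of_mem_adjoin_lefschetzStar`
("all elements of `ℚ[L, Λ]` are Lefschetz") and `Polarization.apply_mem_map_divisorClasses_of_mem_adjoin_lefschetzStar` (Prop. 5.7 for
`T ∈ ℚ[e_E, *_L]`)), now read for `w` and `*_H` on the carrier `⋀_ℚ V` of a polarized `ℚ`-Hodge structure of odd weight.

## Sources, VERBATIM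

Y. André, *Pour une théorie inconditionnelle des motifs*, Publ. Math. IHÉS **83** (1996) [Andre1996Motifs], §1.1 (p. 10): "`*_H x =
Σ (-1)^{(j-2k)(j-2k+1)/2} (k!/(d-j+k)!) L^{d-j+k} x_{j-2k}`", Prop. 1.2 (p. 11): "Les sous-algèbres `Q_ν[L, *_L]`, `Q_ν[L, *_H]`,
`Q_ν[L, *_L L *_L]`, `Q_ν[L, ᶜΛ]` de `End H(X)` sont égales et contiennent les projecteurs de Künneth", §1.2 (p. 11): "le triplet
`(ᶜΛ, L, h)` définit une représentation de `SL₂` […] l'élément `(0 1 ; −1 0)` de `SL₂` s'envoie sur `± *_H`" (the image of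
`(0 1 ; −1 0)` is `w = exp(ᶜΛ) exp(−L) exp(ᶜΛ)`), §1.3 (pp. 12–13: the operators are compatible with extension of the coefficient field
and with tensor products).
J. S. Milne, *Lefschetz classes on abelian varieties*, Duke Math. J. **96** (1999) [Milne1999LefschetzClasses], p. 664: "PROPOSITION 5.7.
[…] A cohomological correspondence `u` between `A` and `B` is Lefschetz if and only if `ū : H*(A) → H*(B)` commutes with the actions of
`L(A × B)`. If `u` is Lefschetz, then `ū` maps `D(A)_k` into `D(B)_k`." — p. 665 (proof of Thm. 5.9): "Consequently, all elements of
the `ℚ`-algebra `ℚ[L, Λ]` are Lefschetz."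
H. Lange, *Abelian Varieties over the Complex Numbers* (2023) [Lange2023AbelianVarietiesComplex], §7.3.2 (p. 338: the Lefschetz
decomposition is compatible with `⊗ ℂ` and with the action of `Sp(V, E)`).

## What is PROVED (`E = E_Q = Q.lefschetzClass`, `Θ = toComplexAlg V`, `S = Q.lefschetzGroupBaseChange ℂ`, `dim V = 2g`, `n` odd)

* §1 **BASE CHANGE — `IsSymplectic.toComplexAlg_weylStar`, `IsSymplectic.toComplexAlg_andreStar`: `Θ (w x) = w_ℂ (Θ x)`,
  `Θ (*_H x) = *_{H,ℂ} (Θ x)`** for every symplectic `ω ∈ ⋀²_ℚ V` whose complexification is symplectic of the same genus (both sides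
  are `ℚ`-linear and agree on the strings `ωʳ ∧ p`, `p` primitive, where the coefficients `(−1)^{g−k+r} r!/(g−k−r)!`, resp.
  `(−1)^{k(k+1)/2} r!/(g−k−r)!`, are RATIONAL); on the carrier `Polarization.toComplexAlg_weylStar` / `Polarization.toComplexAlg_andreStar`.
* §2 **`S(H)(ℂ)`-EQUIVARIANCE — `Polarization.map_weylStar_eq_of_mem_lefschetzGroupBaseChange`,
  `Polarization.map_andreStar_eq_of_mem_lefschetzGroupBaseChange`** (`⋀(γ) Θ E = Θ E` for `γ ∈ S(H)(ℂ)` by Cor. 4.5, then g31-#3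
  `IsSymplectic.map_weylStar` / `map_andreStar`); hence **`Polarization.forall_map_toComplexAlg_weylStar_eq`**,
  **`Polarization.forall_map_toComplexAlg_andreStar_eq`**: if `Θ x` is fixed by `S(H)(ℂ)` so are `Θ (w x)` and `Θ (*_H x)`.
* §3 **THM. 5.9 FOR `w` AND `*_H` — `Polarization.weylStar_apply_mem_adjoin_hodgeClasses_two`,
  `Polarization.andreStar_apply_mem_adjoin_hodgeClasses_two`: `w ℚ[B¹] ⊆ ℚ[B¹]`, `*_H ℚ[B¹] ⊆ ℚ[B¹]`** (`w, *_H ∈ ℚ[e_E, *_L] = ℚ[L, Λ]`,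
  "all elements of `ℚ[L, Λ]` are Lefschetz").
* §4 **PROP. 5.7 FOR `w` AND `*_H` — `Polarization.weylStar_apply_mem_map_divisorClasses_of_add_eq`,
  `Polarization.andreStar_apply_mem_map_divisorClasses_of_add_eq`: `w Dᵖ ⊆ Dᵐ`, `*_H Dᵖ ⊆ Dᵐ` for all `p + m = g`**, and the equalities
  **`Polarization.map_weylStar_divisorClasses_eq_of_add_eq`, `Polarization.map_andreStar_divisorClasses_eq_of_add_eq`: `w Dᵖ = Dᵐ`,
  `*_H Dᵖ = Dᵐ`** (two inclusions and `w² = ±1` on `⋀^{2m}`, `*_H² = 1`).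

## References

* [Andre1996Motifs] Y. André, *Pour une théorie inconditionnelle des motifs*, Publ. Math. IHÉS 83 (1996), §1.1 (p. 10), Prop. 1.2 and
  §1.2 (p. 11), §1.3 (pp. 12–13).
* [Milne1999LefschetzClasses] J. S. Milne, *Lefschetz classes on abelian varieties*, Duke Math. J. 96 (1999), §5 Prop. 5.7, Thm. 5.9
  (pp. 664–665); §4 Cor. 4.5 (p. 659).
* [Lange2023AbelianVarietiesComplex] H. Lange, *Abelian Varieties over the Complex Numbers* (2023), §7.3.2 (1)–(3) (p. 338).
-/

noncomputable section

open scoped TensorProduct Nat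

namespace Literature.AlgebraicGeometry.Motives

universe u

/-! ## §1 Base change `Θ : ⋀_ℚ V → ⋀_ℂ V_ℂ` of `w` and `*_H` -/

namespace ExteriorLefschetz

open Literature.Algebra.Lie ExteriorAlgebra
open Literature.Algebra.Lie.HasLefschetzProperty (primitiveSpace)

section BaseChange

variable {V : Type u} [AddCommGroup V] [Module ℚ V] {ω : ExteriorAlgebra ℚ V} {g : ℕ}

/-- **`w` commutes with the base change `ℚ → ℂ`: `Θ (w x) = w_ℂ (Θ x)`** (`ω`, `Θ ω` symplectic of genus `g`): both sides are `ℚ`-linear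
in `x` and agree on the strings `ωʲ ∧ p` (`p ∈ P_{-k}`, `j ≤ k`), where both equal `(−1)^{k+j} (j!/(k−j)!) (Θω)^{k-j} ∧ Θp` — the
coefficients of `w = exp(ᶜΛ) exp(−L) exp(ᶜΛ)` on the Lefschetz components are rational. [cite: Andre1996Motifs, §1.2 (p. 11) and §1.3 (p. 12)]
[cite: Lange2023AbelianVarietiesComplex, §7.3.2 (3) (p. 338)] -/
theorem IsSymplectic.toComplexAlg_weylStar (hω : IsSymplectic ω g) (hωC : IsSymplectic (toComplexAlg V ω) g)
    (x : ExteriorAlgebra ℚ V) :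
    toComplexAlg V (weylStar ω g x) = weylStar (toComplexAlg V ω) g (toComplexAlg V x) := by
  haveI := hω.finiteDimensional_exteriorAlgebra
  haveI := hωC.finiteDimensional_exteriorAlgebra
  suffices h : (toComplexAlg V).toLinearMap ∘ₗ weylStar ω g =
      ((weylStar (toComplexAlg V ω) g).restrictScalars ℚ) ∘ₗ (toComplexAlg V).toLinearMap from
    LinearMap.congr_fun h x
  refine hω.hasLefschetzProperty_mul.linearMap_ext_of_strings (isZGrading_shiftedDegree ℚ (fun i : ℕ ↦ ⋀[ℚ]^i V) g) ?_
  intro k p hp j hj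
  rw [LinearMap.comp_apply, LinearMap.comp_apply, AlgHom.toLinearMap_apply, AlgHom.toLinearMap_apply,
    LinearMap.restrictScalars_apply]
  by_cases hk : k ≤ g
  · have key := hωC.hasLefschetzProperty_mul.weylOperator_apply_pow_primitive
      (isZGrading_shiftedDegree ℂ (fun i : ℕ ↦ ⋀[ℂ]^i (ℂ ⊗[ℚ] V)) g) (toComplexAlg_mem_primitiveSpace hk hp) hj
    rw [hω.weylStar_eq, hω.hasLefschetzProperty_mul.weylOperator_apply_pow_primitive _ hp hj, map_smul, mul_pow_eq_mul_pow,
      mul_pow_eq_mul_pow, LinearMap.mul_apply', LinearMap.mul_apply', map_mul, map_pow, map_mul, map_pow,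
      ← algebraMap_smul ℂ ((-1 : ℚ) ^ (k + j) * ((j ! : ℕ) : ℚ) * (((k - j) ! : ℕ) : ℚ)⁻¹), map_mul, map_mul, map_inv₀,
      map_natCast, map_natCast, map_pow, map_neg, map_one]
    rw [mul_pow_eq_mul_pow, mul_pow_eq_mul_pow, LinearMap.mul_apply', LinearMap.mul_apply', ← hωC.weylStar_eq] at key
    exact key.symm
  · rw [primitiveSpace_shiftedDegree_mul_eq_bot ω g (not_le.1 hk), Submodule.mem_bot] at hp
    simp only [hp, map_zero]

/-- **`*_H` commutes with the base change `ℚ → ℂ`: `Θ (*_H x) = *_{H,ℂ} (Θ x)`** (`ω`, `Θ ω` symplectic of genus `g`; on a string both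
sides are `(−1)^{(g−k)(g−k+1)/2} (j!/(k−j)!) (Θω)^{k-j} ∧ Θp` — André's formula has rational coefficients, the same over every
coefficient field `Q_ν`). [cite: Andre1996Motifs, §1.1 (p. 10) and §1.3 (p. 12)] [cite: Lange2023AbelianVarietiesComplex, §7.3.2 (3) (p. 338)] -/
theorem IsSymplectic.toComplexAlg_andreStar (hω : IsSymplectic ω g) (hωC : IsSymplectic (toComplexAlg V ω) g)
    (x : ExteriorAlgebra ℚ V) :
    toComplexAlg V (andreStar ω g x) = andreStar (toComplexAlg V ω) g (toComplexAlg V x) := by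
  haveI := hω.finiteDimensional_exteriorAlgebra
  haveI := hωC.finiteDimensional_exteriorAlgebra
  suffices h : (toComplexAlg V).toLinearMap ∘ₗ andreStar ω g =
      ((andreStar (toComplexAlg V ω) g).restrictScalars ℚ) ∘ₗ (toComplexAlg V).toLinearMap from
    LinearMap.congr_fun h x
  refine hω.hasLefschetzProperty_mul.linearMap_ext_of_strings (isZGrading_shiftedDegree ℚ (fun i : ℕ ↦ ⋀[ℚ]^i V) g) ?_
  intro k p hp j hj
  rw [LinearMap.comp_apply, LinearMap.comp_apply, AlgHom.toLinearMap_apply, AlgHom.toLinearMap_apply,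
    LinearMap.restrictScalars_apply]
  by_cases hk : k ≤ g
  · have key := hωC.hasLefschetzProperty_mul.andreHodgeInvolution_apply_pow_primitive
      (isZGrading_shiftedDegree ℂ (fun i : ℕ ↦ ⋀[ℂ]^i (ℂ ⊗[ℚ] V)) g) g (toComplexAlg_mem_primitiveSpace hk hp) hj
    rw [hω.andreStar_eq, hω.hasLefschetzProperty_mul.andreHodgeInvolution_apply_pow_primitive _ g hp hj, map_smul,
      mul_pow_eq_mul_pow, mul_pow_eq_mul_pow, LinearMap.mul_apply', LinearMap.mul_apply', map_mul, map_pow, map_mul, map_pow,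
      ← algebraMap_smul ℂ ((-1 : ℚ) ^ ((g - k) * (g - k + 1) / 2) * ((j ! : ℕ) : ℚ) * (((k - j) ! : ℕ) : ℚ)⁻¹), map_mul, map_mul,
      map_inv₀, map_natCast, map_natCast, map_pow, map_neg, map_one]
    rw [mul_pow_eq_mul_pow, mul_pow_eq_mul_pow, LinearMap.mul_apply', LinearMap.mul_apply', ← hωC.andreStar_eq] at key
    exact key.symm
  · rw [primitiveSpace_shiftedDegree_mul_eq_bot ω g (not_le.1 hk), Submodule.mem_bot] at hp
    simp only [hp, map_zero]

end BaseChange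

end ExteriorLefschetz

namespace HodgeStructure

open ExteriorLefschetz ExteriorAlgebra

variable {V : Type u} [AddCommGroup V] [Module ℚ V] [Module.Finite ℚ V] {n : ℤ} {H : HodgeStructure V n}
  (Q : Polarization H) (hn : Odd n) {g : ℕ} (hg : Module.finrank ℚ V = 2 * g)

/-! ### §1 (carrier) `Θ ∘ w = w_ℂ ∘ Θ`, `Θ ∘ *_H = *_{H,ℂ} ∘ Θ` for `E = E_Q` -/

include hn hg in
/-- **`Θ (w x) = w_ℂ (Θ x)` for the Lefschetz class `E_Q`** (`Θ E_Q` is symplectic of genus `g`). [cite: Andre1996Motifs, §1.2–§1.3 (pp. 11–12)]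
[cite: Lange2023AbelianVarietiesComplex, §7.3.2 (p. 338)] -/
theorem Polarization.toComplexAlg_weylStar (x : ExteriorAlgebra ℚ V) :
    toComplexAlg V (weylStar (Q.lefschetzClass : ExteriorAlgebra ℚ V) g x) =
      weylStar (toComplexAlg V (Q.lefschetzClass : ExteriorAlgebra ℚ V)) g (toComplexAlg V x) :=
  (Q.isSymplectic_lefschetzClass hn hg).toComplexAlg_weylStar (Q.isSymplectic_toComplexAlg_lefschetzClass hn hg) x

include hn hg in
/-- **`Θ (*_H x) = *_{H,ℂ} (Θ x)` for the Lefschetz class `E_Q`.** [cite: Andre1996Motifs, §1.1 and §1.3 (pp. 10, 12)]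
[cite: Lange2023AbelianVarietiesComplex, §7.3.2 (3) (p. 338)] -/
theorem Polarization.toComplexAlg_andreStar (x : ExteriorAlgebra ℚ V) :
    toComplexAlg V (andreStar (Q.lefschetzClass : ExteriorAlgebra ℚ V) g x) =
      andreStar (toComplexAlg V (Q.lefschetzClass : ExteriorAlgebra ℚ V)) g (toComplexAlg V x) :=
  (Q.isSymplectic_lefschetzClass hn hg).toComplexAlg_andreStar (Q.isSymplectic_toComplexAlg_lefschetzClass hn hg) x

/-! ## §2 `S(H)(ℂ)`-equivariance of `w_ℂ` and `*_{H,ℂ}` -/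

include hn hg in
/-- **`⋀(γ) (w_ℂ X) = w_ℂ (⋀(γ) X)` for `γ ∈ S(H)(ℂ)`** (`⋀(γ) Θ E = Θ E` by Cor. 4.5, and g31-#3 `IsSymplectic.map_weylStar`).
[cite: Milne1999LefschetzClasses, §5 Prop. 5.7 and Thm. 5.9 (proof, p. 665), §4 Cor. 4.5] [cite: Andre1996Motifs, §1.2 (p. 11)] -/
theorem Polarization.map_weylStar_eq_of_mem_lefschetzGroupBaseChange {γ : (ℂ ⊗[ℚ] V) ≃ₗ[ℂ] (ℂ ⊗[ℚ] V)}
    (hγ : γ ∈ Q.lefschetzGroupBaseChange ℂ) (X : ExteriorAlgebra ℂ (ℂ ⊗[ℚ] V)) :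
    ExteriorAlgebra.map (γ : ℂ ⊗[ℚ] V →ₗ[ℂ] ℂ ⊗[ℚ] V) (weylStar (toComplexAlg V (Q.lefschetzClass : ExteriorAlgebra ℚ V)) g X) =
      weylStar (toComplexAlg V (Q.lefschetzClass : ExteriorAlgebra ℚ V)) g
        (ExteriorAlgebra.map (γ : ℂ ⊗[ℚ] V →ₗ[ℂ] ℂ ⊗[ℚ] V) X) :=
  (Q.isSymplectic_toComplexAlg_lefschetzClass hn hg).map_weylStar _
    (Q.map_toComplexAlg_lefschetzClass_eq_of_mem_lefschetzGroupBaseChange hn hγ) X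

include hn hg in
/-- **`⋀(γ) (*_{H,ℂ} X) = *_{H,ℂ} (⋀(γ) X)` for every `γ ∈ S(H)(ℂ)`** ("`*_H` commutes with the action of `L(A)`").
[cite: Milne1999LefschetzClasses, §5 Prop. 5.7 and Thm. 5.9 (pp. 664–665)] [cite: Andre1996Motifs, Prop. 1.2 (p. 11)] -/
theorem Polarization.map_andreStar_eq_of_mem_lefschetzGroupBaseChange {γ : (ℂ ⊗[ℚ] V) ≃ₗ[ℂ] (ℂ ⊗[ℚ] V)}
    (hγ : γ ∈ Q.lefschetzGroupBaseChange ℂ) (X : ExteriorAlgebra ℂ (ℂ ⊗[ℚ] V)) :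
    ExteriorAlgebra.map (γ : ℂ ⊗[ℚ] V →ₗ[ℂ] ℂ ⊗[ℚ] V) (andreStar (toComplexAlg V (Q.lefschetzClass : ExteriorAlgebra ℚ V)) g X) =
      andreStar (toComplexAlg V (Q.lefschetzClass : ExteriorAlgebra ℚ V)) g
        (ExteriorAlgebra.map (γ : ℂ ⊗[ℚ] V →ₗ[ℂ] ℂ ⊗[ℚ] V) X) :=
  (Q.isSymplectic_toComplexAlg_lefschetzClass hn hg).map_andreStar _
    (Q.map_toComplexAlg_lefschetzClass_eq_of_mem_lefschetzGroupBaseChange hn hγ) X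

include hn hg in
/-- **If `Θ x` is fixed by `S(H)(ℂ)`, so is `Θ (w x)`.** [cite: Milne1999LefschetzClasses, §5 Thm. 5.9 (proof, p. 665)] [cite: Andre1996Motifs, §1.2 (p. 11)] -/
theorem Polarization.forall_map_toComplexAlg_weylStar_eq {x : ExteriorAlgebra ℚ V}
    (hx : ∀ γ ∈ Q.lefschetzGroupBaseChange ℂ,
      ExteriorAlgebra.map (γ : ℂ ⊗[ℚ] V →ₗ[ℂ] ℂ ⊗[ℚ] V) (toComplexAlg V x) = toComplexAlg V x) :
    ∀ γ ∈ Q.lefschetzGroupBaseChange ℂ,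
      ExteriorAlgebra.map (γ : ℂ ⊗[ℚ] V →ₗ[ℂ] ℂ ⊗[ℚ] V)
          (toComplexAlg V (weylStar (Q.lefschetzClass : ExteriorAlgebra ℚ V) g x)) =
        toComplexAlg V (weylStar (Q.lefschetzClass : ExteriorAlgebra ℚ V) g x) := fun γ hγ ↦ by
  rw [Q.toComplexAlg_weylStar hn hg, Q.map_weylStar_eq_of_mem_lefschetzGroupBaseChange hn hg hγ, hx γ hγ]

include hn hg in
/-- **If `Θ x` is fixed by `S(H)(ℂ)`, so is `Θ (*_H x)`.** [cite: Milne1999LefschetzClasses, §5 Prop. 5.7 and Thm. 5.9 (pp. 664–665)]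
[cite: Andre1996Motifs, Prop. 1.2 (p. 11)] -/
theorem Polarization.forall_map_toComplexAlg_andreStar_eq {x : ExteriorAlgebra ℚ V}
    (hx : ∀ γ ∈ Q.lefschetzGroupBaseChange ℂ,
      ExteriorAlgebra.map (γ : ℂ ⊗[ℚ] V →ₗ[ℂ] ℂ ⊗[ℚ] V) (toComplexAlg V x) = toComplexAlg V x) :
    ∀ γ ∈ Q.lefschetzGroupBaseChange ℂ,
      ExteriorAlgebra.map (γ : ℂ ⊗[ℚ] V →ₗ[ℂ] ℂ ⊗[ℚ] V)
          (toComplexAlg V (andreStar (Q.lefschetzClass : ExteriorAlgebra ℚ V) g x)) =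
        toComplexAlg V (andreStar (Q.lefschetzClass : ExteriorAlgebra ℚ V) g x) := fun γ hγ ↦ by
  rw [Q.toComplexAlg_andreStar hn hg, Q.map_andreStar_eq_of_mem_lefschetzGroupBaseChange hn hg hγ, hx γ hγ]

/-! ## §3 Thm. 5.9 for `w` and `*_H`: both preserve the `ℚ`-algebra of Lefschetz classes `ℚ[B¹] = (⋀_ℚ V)^{S(H)(ℂ)}` -/

include hn hg in
/-- **`w` is Lefschetz: `w ℚ[B¹] ⊆ ℚ[B¹]`** (`w ∈ ℚ[e_E, *_L]`, g31-#3 `IsSymplectic.weylStar_mem_adjoin_lefschetzStar`, and "all elements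
of the `ℚ`-algebra `ℚ[L, Λ]` are Lefschetz"). [cite: Milne1999LefschetzClasses, §5 Thm. 5.9 (pp. 664–665)] [cite: Andre1996Motifs, §1.2 and Prop. 1.2 (p. 11)] -/
theorem Polarization.weylStar_apply_mem_adjoin_hodgeClasses_two {x : ExteriorAlgebra ℚ V}
    (hx : x ∈ Algebra.adjoin ℚ (((H.exteriorPower 2).hodgeClasses n).map (⋀[ℚ]^2 V).subtype : Set (ExteriorAlgebra ℚ V))) :
    weylStar (Q.lefschetzClass : ExteriorAlgebra ℚ V) g x ∈
      Algebra.adjoin ℚ (((H.exteriorPower 2).hodgeClasses n).map (⋀[ℚ]^2 V).subtype : Set (ExteriorAlgebra ℚ V)) :=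
  Q.apply_mem_adjoin_hodgeClasses_two_of_mem_adjoin_lefschetzStar hn hg
    ((Q.isSymplectic_lefschetzClass hn hg).weylStar_mem_adjoin_lefschetzStar) hx

include hn hg in
/-- **`*_H` is Lefschetz: `*_H ℚ[B¹] ⊆ ℚ[B¹]`** (`*_H ∈ ℚ[e_E, *_L]`, g31-#3 `IsSymplectic.andreStar_mem_adjoin_lefschetzStar`).
[cite: Milne1999LefschetzClasses, §5 Thm. 5.9 (pp. 664–665)] [cite: Andre1996Motifs, Prop. 1.2 (p. 11)] -/
theorem Polarization.andreStar_apply_mem_adjoin_hodgeClasses_two {x : ExteriorAlgebra ℚ V}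
    (hx : x ∈ Algebra.adjoin ℚ (((H.exteriorPower 2).hodgeClasses n).map (⋀[ℚ]^2 V).subtype : Set (ExteriorAlgebra ℚ V))) :
    andreStar (Q.lefschetzClass : ExteriorAlgebra ℚ V) g x ∈
      Algebra.adjoin ℚ (((H.exteriorPower 2).hodgeClasses n).map (⋀[ℚ]^2 V).subtype : Set (ExteriorAlgebra ℚ V)) :=
  Q.apply_mem_adjoin_hodgeClasses_two_of_mem_adjoin_lefschetzStar hn hg
    ((Q.isSymplectic_lefschetzClass hn hg).andreStar_mem_adjoin_lefschetzStar) hx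

/-! ## §4 Prop. 5.7 for `w` and `*_H`: `w Dᵖ = Dᵐ`, `*_H Dᵖ = Dᵐ` for all `p + m = g` -/

include hn hg in
/-- **`w Dᵖ ⊆ Dᵐ` for ALL `p + m = g`** (`w` is Lefschetz, hence maps `D(A)` into `D(A)` (Prop. 5.7), and `w ⋀^{2p} ⊆ ⋀^{2g-2p}`).
[cite: Milne1999LefschetzClasses, §5 Prop. 5.7 and Thm. 5.9 (pp. 664–665)] [cite: Andre1996Motifs, §1.2 (p. 11)] -/
theorem Polarization.weylStar_apply_mem_map_divisorClasses_of_add_eq {p m : ℕ} (hpm : p + m = g) {x : ExteriorAlgebra ℚ V}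
    (hx : x ∈ (H.divisorClasses p).map (⋀[ℚ]^(2 * p) V).subtype) :
    weylStar (Q.lefschetzClass : ExteriorAlgebra ℚ V) g x ∈ (H.divisorClasses m).map (⋀[ℚ]^(2 * m) V).subtype :=
  Q.apply_mem_map_divisorClasses_of_mem_adjoin_lefschetzStar hn hg ((Q.isSymplectic_lefschetzClass hn hg).weylStar_mem_adjoin_lefschetzStar)
    (fun _ hy ↦ (Q.isSymplectic_lefschetzClass hn hg).weylStar_apply_mem (by omega) hy) hx

include hn hg in
/-- **`*_H Dᵖ ⊆ Dᵐ` for ALL `p + m = g`.** [cite: Milne1999LefschetzClasses, §5 Prop. 5.7 and Thm. 5.9 (pp. 664–665)] [cite: Andre1996Motifs, Prop. 1.2 (p. 11)] -/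
theorem Polarization.andreStar_apply_mem_map_divisorClasses_of_add_eq {p m : ℕ} (hpm : p + m = g) {x : ExteriorAlgebra ℚ V}
    (hx : x ∈ (H.divisorClasses p).map (⋀[ℚ]^(2 * p) V).subtype) :
    andreStar (Q.lefschetzClass : ExteriorAlgebra ℚ V) g x ∈ (H.divisorClasses m).map (⋀[ℚ]^(2 * m) V).subtype :=
  Q.apply_mem_map_divisorClasses_of_mem_adjoin_lefschetzStar hn hg ((Q.isSymplectic_lefschetzClass hn hg).andreStar_mem_adjoin_lefschetzStar)
    (fun _ hy ↦ (Q.isSymplectic_lefschetzClass hn hg).andreStar_apply_mem (by omega) hy) hx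

include hn hg in
/-- **`w Dᵖ = Dᵐ` for ALL `p + m = g`** (as sub-spaces of `⋀_ℚ V`): the inclusions `w Dᵖ ⊆ Dᵐ`, `w Dᵐ ⊆ Dᵖ` and `w² = (−1)^{2m+g} = (−1)^g`
on `⋀^{2m}` (so `y = w ((−1)^g w y)`). [cite: Milne1999LefschetzClasses, §5 Prop. 5.7 and Thm. 5.9 (pp. 664–665)] [cite: Andre1996Motifs, §1.2 (p. 11)] -/
theorem Polarization.map_weylStar_divisorClasses_eq_of_add_eq {p m : ℕ} (hpm : p + m = g) :
    (H.divisorClasses p).map (weylStar (Q.lefschetzClass : ExteriorAlgebra ℚ V) g ∘ₗ (⋀[ℚ]^(2 * p) V).subtype) =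
      (H.divisorClasses m).map (⋀[ℚ]^(2 * m) V).subtype := by
  refine le_antisymm ?_ fun y hy ↦ ?_
  · rintro _ ⟨x, hx, rfl⟩
    exact Q.weylStar_apply_mem_map_divisorClasses_of_add_eq hn hg hpm ⟨x, hx, rfl⟩
  · obtain ⟨z, hz, hzy⟩ := Q.weylStar_apply_mem_map_divisorClasses_of_add_eq hn hg (p := m) (m := p) (by omega) hy
    have hy2 : y ∈ ⋀[ℚ]^(2 * m) V := by
      obtain ⟨y', -, rfl⟩ := hy
      exact y'.2
    refine ⟨((-1 : ℚ) ^ g) • z, Submodule.smul_mem _ _ hz, ?_⟩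
    rw [LinearMap.comp_apply, map_smul, map_smul, hzy, (Q.isSymplectic_lefschetzClass hn hg).weylStar_weylStar_apply_of_mem hy2,
      smul_smul, ← pow_add, Even.neg_one_pow (by rw [Nat.even_iff]; omega), one_smul]

include hn hg in
/-- **`*_H Dᵖ = Dᵐ` for ALL `p + m = g`** (both inclusions and `*_H² = 1`). [cite: Milne1999LefschetzClasses, §5 Prop. 5.7 and Thm. 5.9 (pp. 664–665)]
[cite: Andre1996Motifs, §1.1 (p. 10, "involutions") and Prop. 1.2 (p. 11)] -/
theorem Polarization.map_andreStar_divisorClasses_eq_of_add_eq {p m : ℕ} (hpm : p + m = g) :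
    (H.divisorClasses p).map (andreStar (Q.lefschetzClass : ExteriorAlgebra ℚ V) g ∘ₗ (⋀[ℚ]^(2 * p) V).subtype) =
      (H.divisorClasses m).map (⋀[ℚ]^(2 * m) V).subtype := by
  refine le_antisymm ?_ fun y hy ↦ ?_
  · rintro _ ⟨x, hx, rfl⟩
    exact Q.andreStar_apply_mem_map_divisorClasses_of_add_eq hn hg hpm ⟨x, hx, rfl⟩
  · obtain ⟨z, hz, hzy⟩ := Q.andreStar_apply_mem_map_divisorClasses_of_add_eq hn hg (p := m) (m := p) (by omega) hy
    refine ⟨z, hz, ?_⟩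
    rw [LinearMap.comp_apply, hzy, ← Module.End.mul_apply, (Q.isSymplectic_lefschetzClass hn hg).andreStar_mul_self,
      Module.End.one_apply]

end HodgeStructure

end Literature.AlgebraicGeometry.Motives
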